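/-
Copyright (c) 2026. All rights reserved.
Released under Apache 2.0 license as described in the file LICENSE.
Authors: abc-iut cell, statement-typer seat abc-iut-L4-t3 (wave 1).
-/
import Literature.AnabelianGeometry.AbsoluteAnabelian.DiagramOverMorphismsFamilies
import Literature.AnabelianGeometry.AbsoluteAnabelian.LogFrobeniusTelecoreExtensions
import Literature.AnabelianGeometry.AbsoluteAnabelian.LogFrobeniusTelecoreShiftHolds
import HarnessLib

/-!
# [AbsTopIII] Corollary 5.5 (vi), telecore clause: the panalocalization morphism extends to the telecore diagrams and is
# compatible with `𝔗_{An•}`, `ℋ_{An•}` — for every panalocalization lying over `𝒳`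

S. Mochizuki, *Topics in absolute anabelian geometry III: global reconstruction algorithms*,
J. Math. Sci. Univ. Tokyo 22 (2015) 939–1156 [MochizukiAbsTopIII2015]; locators `p.N` = pages of the author's
manuscript (`paper:url-5493eb38cbb7`), read on the page: Cor 5.5 (vi) p. 132 ("we obtain a natural panalocalization
morphism of diagrams of categories `D⊚ → D✠` … compatible with the cores of (i), the telecore and contact structures of
(ii), the observables of (iii), and the `ℤ`-actions of (v)"), Def 5.1 (vi) pp. 117–118 ("`Th⊚_T → Th✠_T` — lying over
the functor `Th⊚ → Th✠` of (iv)"), Def 3.5 (v) p. 76 (compatibility of a 1-morphism with families of homotopies),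
Rmk 3.5.1 p. 78 (the "constant portions" under a diagram).

PROOF-SIDE companion of `LogFrobeniusTelecoreExtensions.lean` (this seat: the TELECORE CLAUSE of Cor 5.5 (vi) as the
`Prop` `Panalocalization.Cor55PanalocalizationTelecore P`, an assumption on the panalocalization `P : D⊚⊢ → D✠⊢`).
Contents, for ANY panalocalization `P` between settings `L₁` (`• = ⊚`) and `L₂` (`• = ✠`):

* `Panalocalization.telecoreHom P` — the 1-morphism of the telecore diagrams `Ψ_P : D⊚_{An•} → D✠_{An•}` induced by `P`
  (Def 3.5 (v); over the identity of the common oriented graph: `P`'s functors on `D•_{≤5}`, `panAn` at the core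
  vertex `An•[𝒳]`, the 2-cells `isoκAn` at the observation edge and `isoφAn` at the telecore edges `φ_⋏`), with
  `telecoreHom_extendsToTelecore : P.ExtendsToTelecore (𝟭q _) P.telecoreHom` (all clauses by `rfl`);
* `Panalocalization.TelecoreOverHom P` — the DATUM "`Ψ_P` lies over the panalocalization functor
  `Φ_𝒳 = P.panT : Th⊚_T[Z] → Th✠_T[Z]` with respect to the structure functors of `D_{An•}` over `𝒳`" (this seat's
  `contactOver`, gen 4; abc-iut-L4-t5's `OverData`): isomorphisms `θ_v : Ψ_v ⋙ N✠_v ≅ N⊚_v ⋙ Φ_𝒳` and one commutative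
  prism per arrow (`DiagramOfCategories.OneMorphism.OverHom`).  This is the print's "lying over" (Def 5.1 (vi)) made
  explicit for the whole telecore diagram: its content beyond `P`'s own 2-cells is the compatibility of those 2-cells
  with `logIsoId` (Def 5.4 (ii)), `lamOver` (Def 5.4 (iv)) and `η_{An•}` (Cor 5.5 (ii)) of the two settings — genuine
  coherence DATA not recorded by the interface `Panalocalization`, exactly as `CompatibleWithTelecoreData` is;
* **`cor55PanalocalizationTelecore_of_overHom`** — for every `P` equipped with that datum and `V(F_mod) ≠ ∅`, the typed
  telecore clause of Cor 5.5 (vi) HOLDS: `Ψ_P` is compatible, in the sense of Def 3.5 (v), with the telecore families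
  `𝔍⊚`, `𝔍✠` of `𝔗_{An⊚}`, `𝔗_{An✠}` (gen 4's `contactTelecore`) and with the contact structures `ℋ_{An⊚}`, `ℋ_{An✠}`
  generated by the printed homotopies (gen 4's `contactFamily`) — by the toolkit theorem
  `OverHom.compatibleWithRestrict` (`DiagramOverMorphismsFamilies.lean`): the homotopies of the universal families are
  whiskered lifts through the fully faithful structure functors at `An•[𝒳]`, `□`, `𝒳_⋎`, and such lifts commute with
  any 1-morphism lying over the bases;
* `cor55PanalocalizationTelecore_iff_nonempty_of_overHom` — with the datum, the clause holds iff `V(F_mod) ≠ ∅`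
  (necessity is `not_cor55PanalocalizationTelecore_of_isEmpty`).

HONEST LABEL: the clause is proved for every `P` OVER THE COHERENCE DATUM `TelecoreOverHom P` (print's "natural …
lying over"); it is not provable for a bare `Panalocalization` (whose 2-cells are unconstrained).  Refereed pre-IUT
material; nothing here bears on [IUTchIII] Cor. 3.12; OUR kernel check, no side taken; typed ≠ proved.
-/

set_option autoImplicit false

noncomputable section

universe u

open CategoryTheory Quiver

namespace Literature.AnabelianGeometry.AbsoluteAnabelian

namespace Panalocalization

open DiagramOfCategories LogFrobeniusSetting

variable {Vmod : Type u} {isArc : Vmod → Bool} {L₁ L₂ : LogFrobeniusSetting Vmod isArc} (P : Panalocalization L₁ L₂)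

/-! ## The 1-morphism of the telecore diagrams induced by a panalocalization -/

/-- the functors of `Ψ_P : D⊚_{An•} → D✠_{An•}` at the vertices: `P`'s functors on `D•_{≤5}`, `panAn` at `An•[𝒳]`.
[cite: MochizukiAbsTopIII2015, Cor 5.5 (vi) p. 132] -/
def telecoreApp : (w : (anTelecoreShape (Vmod := Vmod) (isArc := isArc) anTelJ).Vertex) →
    ((L₁.anTelecoreDiagram anTelJ (fun {a} j => L₁.telecoreFun a.1 j)).obj w ⥤
      (L₂.anTelecoreDiagram anTelJ (fun {a} j => L₂.telecoreFun a.1 j)).obj w)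
  | ExtVertex.base a => P.app a.1
  | ExtVertex.obs => P.panAn

/-- the 2-cells of `Ψ_P` at the telecore edges `φ_⋏ : An•[𝒳] → 𝒳_⋏`, `⋏ ∈ L ∪ {□}`: copies of `isoφAn`.
[cite: MochizukiAbsTopIII2015, Cor 5.5 (vi) p. 132] -/
def telecoreIsoTel : ∀ (b : DSub (InFive (Vmod := Vmod) (isArc := isArc))) (j : anTelJ (isArc := isArc) b),
    P.panAn ⋙ L₂.telecoreFun b.1 j ≅ L₁.telecoreFun b.1 j ⋙ P.app b.1
  | ⟨.row1 _, _⟩, _ => P.isoφAn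
  | ⟨.core, _⟩, _ => P.isoφAn
  | ⟨.nplus _, _⟩, j => PEmpty.elim j
  | ⟨.nv _, _⟩, j => PEmpty.elim j
  | ⟨.e5, _⟩, j => PEmpty.elim j
  | ⟨.an, _⟩, j => PEmpty.elim j
  | ⟨.e7, _⟩, j => PEmpty.elim j
  | ⟨.nmonoPlus _, _⟩, j => PEmpty.elim j
  | ⟨.nmono _, _⟩, j => PEmpty.elim j
  | ⟨.emono5, _⟩, j => PEmpty.elim j
  | ⟨.anMono, _⟩, j => PEmpty.elim j
  | ⟨.emono7, _⟩, j => PEmpty.elim j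

/-- the 2-cell of `Ψ_P` at the observation edge `κ_{An•} : ℰ• → An•[𝒳]`: `isoκAn`.
[cite: MochizukiAbsTopIII2015, Cor 5.5 (vi) p. 132] -/
def telecoreIsoObs : ∀ (a : DSub (InFive (Vmod := Vmod) (isArc := isArc))) (i : DEdge isArc a.1 .an),
    P.app a.1 ⋙ DEdge.functor L₂ i ≅ DEdge.functor L₁ i ⋙ P.panAn
  | ⟨_, _⟩, .κAn => P.isoκAn

/-- the 2-cells of `Ψ_P` at all edges of `Γ⃗_{D_{An•}}`. [cite: MochizukiAbsTopIII2015, Cor 5.5 (vi) p. 132] -/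
def telecoreIso : ∀ {w w' : (anTelecoreShape (Vmod := Vmod) (isArc := isArc) anTelJ).Vertex} (e : w ⟶ w'),
    P.telecoreApp w ⋙ (L₂.anTelecoreDiagram anTelJ (fun {a} j => L₂.telecoreFun a.1 j)).map e ≅
      (L₁.anTelecoreDiagram anTelJ (fun {a} j => L₁.telecoreFun a.1 j)).map e ⋙ P.telecoreApp w'
  | ExtVertex.base _, ExtVertex.base _, e => P.iso e
  | ExtVertex.base a, ExtVertex.obs, i => P.telecoreIsoObs a i
  | ExtVertex.obs, ExtVertex.base b, j => P.telecoreIsoTel b j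
  | ExtVertex.obs, ExtVertex.obs, e => PEmpty.elim e

/-- **`Ψ_P : D⊚_{An•} → D✠_{An•}`**, the 1-morphism of the telecore diagrams (Def 3.5 (v)) induced by the panalocalization,
over the identity of the common oriented graph `Γ⃗_{D_{An•}}`. [cite: MochizukiAbsTopIII2015, Cor 5.5 (vi) p. 132] -/
def telecoreHom : OneMorphism (𝟭q _) (L₁.anTelecoreDiagram anTelJ (fun {a} j => L₁.telecoreFun a.1 j))
    (L₂.anTelecoreDiagram anTelJ (fun {a} j => L₂.telecoreFun a.1 j)) where
  app := P.telecoreApp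
  iso e := P.telecoreIso e

/-- `Ψ_P` extends the panalocalization `P` (`ExtendsToTelecore`: identity on the common shape, `P`'s functors on
`D•_{≤5}`, `panAn` at the core vertex). [cite: MochizukiAbsTopIII2015, Cor 5.5 (vi) p. 132] -/
theorem telecoreHom_extendsToTelecore : P.ExtendsToTelecore (𝟭q _) P.telecoreHom :=
  ⟨fun _ => ⟨rfl, HEq.rfl⟩, fun _ => HEq.rfl, fun _ => HEq.rfl, rfl, HEq.rfl⟩

/-! ## The coherence datum: `Ψ_P` lies over `Φ_𝒳 : Th⊚_T[Z] → Th✠_T[Z]` -/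

/-- The DATUM "the panalocalization lies over the panalocalization functor `Th⊚_T[Z] → Th✠_T[Z]` with respect to the
structure functors of the telecore diagrams over `𝒳 = Th•_T[Z]`" (Def 5.1 (vi): "`Th⊚_T → Th✠_T` — lying over the
functor `Th⊚ → Th✠`"; Rmk 3.5.1: the structure functors exhibit the constant portion under the diagram): isomorphisms
`θ_v : Ψ_v ⋙ N✠_v ≅ N⊚_v ⋙ Φ_𝒳` with one commutative prism per arrow of `D_{An•}` — the compatibility of `P`'s 2-cells with
`logIsoId`, `lamOver`, `η_{An•}` of the two settings (coherence data the interface `Panalocalization` does not record).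
[cite: MochizukiAbsTopIII2015, Def 5.1 (vi) p. 118] -/
abbrev TelecoreOverHom : Type (u + 1) := P.telecoreHom.OverHom L₁.contactOver L₂.contactOver P.panT

/-! ## Cor 5.5 (vi), telecore clause, over the datum -/

/-- the telecore boundary set (pairs decomposable through the core vertex) lies in the boundary set of the universal
family for the fully faithful vertices `{An•[𝒳], □, 𝒳_⋎}`. [cite: MochizukiAbsTopIII2015, Cor 5.5 (ii) p. 131] -/
theorem univE_obs_subset_contactW ⦃a b : (anTelecoreShape (Vmod := Vmod) (isArc := isArc) anTelJ).Vertex⦄ ⦃p q : Path a b⦄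
    (h : univE (· = (anTelecoreShape (Vmod := Vmod) (isArc := isArc) anTelJ).obs) p q) : univE contactW p q :=
  univE_mono (fun w hw => by subst hw; trivial) h

section Holds

variable [Nonempty Vmod]

/-- **Cor 5.5 (vi), telecore clause — PROVED over the coherence datum**: for every panalocalization `P : D⊚⊢ → D✠⊢` lying
over the panalocalization functor `Th⊚_T[Z] → Th✠_T[Z]` (`TelecoreOverHom`) and `V(F_mod) ≠ ∅`, the induced 1-morphism
`Ψ_P : D⊚_{An•} → D✠_{An•}` of the telecore diagrams extends `P` and is compatible, in the sense of Def 3.5 (v), with the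
telecore families `𝔍⊚`, `𝔍✠` of `𝔗_{An⊚}`, `𝔗_{An✠}` and with the contact structures `ℋ_{An⊚}`, `ℋ_{An✠}` generated by
the printed homotopies. [cite: MochizukiAbsTopIII2015, Cor 5.5 (vi) p. 132] -/
theorem cor55PanalocalizationTelecore_of_overHom (H : P.TelecoreOverHom) : P.Cor55PanalocalizationTelecore := by
  obtain ⟨v₀⟩ := ‹Nonempty Vmod›
  refine ⟨_, _, univCoreObs_isCore (obsShape InFive .an) (fun _ => (inferInstance : IsEmpty PEmpty.{u + 1}))
      (L₁.obsExt InFive .an) L₁.contactBase L₁.φAn L₁.contactObsIso L₁.φAnFullyFaithful reach_an,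
    L₁.contactTelecore, rfl, HEq.rfl,
    L₁.contactFamily v₀ (LogVertex.spaceLink _) (spaceLink_isPostLog _) (fun _ => v₀)
      (fun _ => LogVertex.spaceLink _) (fun _ => spaceLink_isPostLog _),
    _, _, univCoreObs_isCore (obsShape InFive .an) (fun _ => (inferInstance : IsEmpty PEmpty.{u + 1}))
      (L₂.obsExt InFive .an) L₂.contactBase L₂.φAn L₂.contactObsIso L₂.φAnFullyFaithful reach_an,
    L₂.contactTelecore, rfl, HEq.rfl,
    L₂.contactFamily v₀ (LogVertex.spaceLink _) (spaceLink_isPostLog _) (fun _ => v₀)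
      (fun _ => LogVertex.spaceLink _) (fun _ => spaceLink_isPostLog _),
    𝟭q _, P.telecoreHom,
    L₁.contactFamily_isContactStructure _ _ _ _ _ _, L₁.contactFamily_isAnContactGenerated _ _ _,
    L₂.contactFamily_isContactStructure _ _ _ _ _ _, L₂.contactFamily_isAnContactGenerated _ _ _,
    P.telecoreHom_extendsToTelecore, ⟨?_⟩, ⟨?_⟩⟩
  · exact H.compatibleWithRestrict contactW L₁.contactFF L₂.contactFF _ (isSaturated_univE _) univE_obs_subset_contactW
  · exact H.compatibleWithRestrict contactW L₁.contactFF L₂.contactFF _ (isSaturated_saturation _)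
      (Saturation.subset (isSaturated_univE _) (L₁.contactGen_subset v₀ (LogVertex.spaceLink _) (spaceLink_isPostLog _)
        (fun _ => v₀) (fun _ => LogVertex.spaceLink _) (fun _ => spaceLink_isPostLog _)))

omit [Nonempty Vmod] in
/-- with the coherence datum, the typed telecore clause of Cor 5.5 (vi) holds EXACTLY when `V(F_mod) ≠ ∅`.
[cite: MochizukiAbsTopIII2015, Cor 5.5 (vi) p. 132] -/
theorem cor55PanalocalizationTelecore_iff_nonempty_of_overHom (H : P.TelecoreOverHom) :
    P.Cor55PanalocalizationTelecore ↔ Nonempty Vmod := by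
  refine ⟨fun h => ?_, fun _ => P.cor55PanalocalizationTelecore_of_overHom H⟩
  by_contra hV
  rw [not_nonempty_iff] at hV
  exact P.not_cor55PanalocalizationTelecore_of_isEmpty h

end Holds

end Panalocalization

end Literature.AnabelianGeometry.AbsoluteAnabelian

end
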